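/-
Copyright (c) 2026. All rights reserved.
Released under Apache 2.0 license as described in the file LICENSE.
Authors: abc-iut cell, prover seat abc-iut-L4-t5 (gen 9), over the statements of abc-iut-L4-t3 and the `⊞`-side move system
of abc-iut-f-101 (`LogFrobeniusObservablesMoves.lean`), of which this file is the `TS`-side analogue.
-/
import Literature.AnabelianGeometry.AbsoluteAnabelian.LogFrobeniusObservablesTSGraph
import HarnessLib

/-!
# [AbsTopIII] Corollary 5.5 (iii), `TS`-half: the MOVE SYSTEM of the observable `S_log` on `(D•_{≤2} ∪ {𝒩⊞_v}) ∪ {𝒩_v}` — generators over ALL of `Γ⃗^log_v`, homotopies, termination, unique decomposition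

S. Mochizuki, *Topics in absolute anabelian geometry III: global reconstruction algorithms*,
J. Math. Sci. Univ. Tokyo 22 (2015) 939–1156 [MochizukiAbsTopIII2015]; locators `p.N` = pages of the author's
manuscript (`paper:url-5493eb38cbb7`): Def 5.4 (iii) p. 126, (v) p. 127, (vii) p. 128 ("respectively,
`ι_{v,ε} : λ_{v,ν₁} ∘ Λ_{ν₁} → λ_{v,ν₂}`" for EVERY edge `ε` of `Γ⃗^log_v`, `λ_{v,ν}` = `λ⊞_{v,ν}` composed with `𝒩⊞_v → 𝒩_v`),
Cor 5.5 (iii) p. 131 ("respectively, [the `ι_{v,ε}`] belong to a family of homotopies on `D•_{≤4}` that determines on the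
portion of `D•_{≤4}` indexed by `v` a structure of observable `S_log` on the portion of `D•_{≤3}` indexed by `v`"), proof
p. 132 ("immediate from the definitions"), §0 p. 26 / Def 3.5 (ii)–(iii) pp. 75–76 (saturation; families of homotopies).

The `TS`-side companion of abc-iut-f-101's `LogFrobeniusObservablesMoves.lean` (the `⊞`-half `S_log⊞` on
`D•_{≤2} ∪ {𝒩⊞_v}`): preparation for the CONSTRUCTION of the observable `S_log` of Cor 5.5 (iii) as typed by abc-iut-L4-t3
(`LogFrobeniusSetting.IsLogObservableTS`, `Cor55ObservablesTS` = FACT-LIST F-3080) from the `TS` ι-diamond law (converse of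
abc-iut-w5-d097's `TSHomotopies.iota_diamond_of_isLogObservableTS`), on abc-iut-L4-t3's shape `logShapeTS v` = the portion
`D•_{≤2} ∪ {𝒩⊞_v}` with observation vertex `𝒩_v` (one more arrow, `𝒩⊞_v → 𝒩_v`, than the `⊞`-shape; at an ARCHIMEDEAN place
the observable was obtained by abc-iut-w5-d053 by push-forward along that arrow, `LogFrobeniusObservablesTSOfPlus.lean`;
the present generic route covers the NONARCHIMEDEAN places, where `Γ⃗^log_v ⊋ Γ⃗^⋉_v`):

* `LogFrobeniusSetting.LogGenTS` — the generator pairs, indexed by `LogEdgeTS` = ALL edges of `Γ⃗^log_v` (at a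
  nonarchimedean place one more than on the `⊞`-side: the `TS`-only arrow `k̄^× ↪ k̄`): (`pre`)
  `([𝒩⊞→𝒩]∘[λ⊞_{ν₁}], [𝒩⊞→𝒩]∘[λ⊞_{ν₂}])` = (`lamPathTS ν₁`, `lamPathTS ν₂`), (`post`)
  (`postLogDomPathTS`, `postLogCodPathTS`); `logGenHomTS T` — their prescribed homotopies, the `TS`-valued `ι_{v,ε}` of a
  `TS`-datum `T : L.TSHomotopies` re-typed along `pathFunctor_lamPathTS` & co.;
* TERMINATION: weights `edgeWtTS` / `pathWtTS` from `LogVertex.rankTS` (`log ↦ 3`), strictly lowered by every move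
  (`pathWtTS_lt_of_move`, `pathWtTS_le_of_chain`, `pathWtTS_lt_of_cons`);
* UNIQUE DECOMPOSITION of the paths of the `TS`-shape ending at `𝒩_v` (`eq_of_comp_lamPathTS_eq`,
  `eq_of_comp_lamPathTS_eq_comp_postLogDomPathTS`, `eq_of_comp_postLogDomPathTS_eq`: one more trailing arrow than on the
  `⊞`-side): the first move of a chain out of a path is determined by the path up to the forks of
  `LogFrobeniusObservablesTSGraph.lean`.

Nothing is asserted about print here (definitions and bookkeeping over the typed interface); the coherence theorem and
the construction of `S_log` are in `LogFrobeniusObservablesTSOfIotaSquare.lean`.  Refereed pre-IUT material; nothing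
here bears on [IUTchIII] Cor. 3.12; no side taken; typed ≠ proved elsewhere.
-/

set_option autoImplicit false

universe u

open CategoryTheory Quiver

namespace Literature.AnabelianGeometry.AbsoluteAnabelian

/-! ## The move system of `(D•_{≤2} ∪ {𝒩⊞_v}) ∪ {𝒩_v}`: weights, generators, homotopies -/

namespace LogFrobeniusSetting

variable {Vmod : Type u} {isArc : Vmod → Bool} (L : LogFrobeniusSetting Vmod isArc) (v : Vmod)

/-- The `TS`-weight of an arrow of `D•⊢`: `3` for `log`, `rankTS ν` for `λ⊞_{v,ν}`, `0` otherwise.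
[cite: MochizukiAbsTopIII2015, Cor 5.5 (iii) p. 131] -/
def _root_.Literature.AnabelianGeometry.AbsoluteAnabelian.DEdge.wtTS :
    {a b : DVertex Vmod isArc} → DEdge isArc a b → ℕ
  | _, _, .log _ => 3
  | _, _, .lam _ ν _ => LogVertex.rankTS _ ν
  | _, _, _ => 0

/-- The weight of an arrow of the `TS`-shape (that of the underlying arrow of `D•⊢`; `0` on the observation arrow
`𝒩⊞_v → 𝒩_v`). [cite: MochizukiAbsTopIII2015, Cor 5.5 (iii) p. 131] -/
def edgeWtTS : {c d : (logShapeTS (isArc := isArc) v).Vertex} → (c ⟶ d) → ℕ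
  | ExtVertex.base _, ExtVertex.base _, e => DEdge.wtTS e
  | ExtVertex.base _, ExtVertex.obs, _ => 0
  | ExtVertex.obs, _, _ => 0

/-- The weight of a path of the `TS`-shape (sum of the weights of its arrows). [cite: MochizukiAbsTopIII2015, Cor 5.5 (iii) p. 131] -/
def pathWtTS {c : (logShapeTS (isArc := isArc) v).Vertex} :
    {d : (logShapeTS (isArc := isArc) v).Vertex} → Path c d → ℕ
  | _, Path.nil => 0
  | _, Path.cons p e => pathWtTS p + edgeWtTS v e

/-- The weight is additive along composition of paths. [cite: MochizukiAbsTopIII2015, Cor 5.5 (iii) p. 131] -/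
theorem pathWtTS_comp {c d d' : (logShapeTS (isArc := isArc) v).Vertex} (r : Path c d) :
    ∀ (p : Path d d'), pathWtTS v (r.comp p) = pathWtTS v r + pathWtTS v p
  | Path.nil => rfl
  | Path.cons p e => by rw [Path.comp_cons, pathWtTS, pathWtTS, pathWtTS_comp r p, Nat.add_assoc]

/-- Weight of `[𝒩⊞_v → 𝒩_v] ∘ [λ⊞_{v,ν}]`. [cite: MochizukiAbsTopIII2015, Cor 5.5 (iii) p. 131] -/
theorem pathWtTS_lamPathTS (ν : LogVertex (isArc v)) (hν : ν.isPostLog = false) :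
    pathWtTS v (lamPathTS (isArc := isArc) v ν hν) = LogVertex.rankTS _ ν := by
  show (0 + LogVertex.rankTS _ ν) + 0 = _
  omega

/-- Weight of `[𝒩⊞_v → 𝒩_v] ∘ [λ⊞_{sl}] ∘ [id_⋎] ∘ [log]`. [cite: MochizukiAbsTopIII2015, Cor 5.5 (iii) p. 131] -/
theorem pathWtTS_postLogDomPathTS (n : ℤ) (hsl : (LogVertex.spaceLink (isArc v)).isPostLog = false) :
    pathWtTS v (postLogDomPathTS (isArc := isArc) v n hsl) = 3 := by
  show (((0 + 3) + 0) + LogVertex.rankTS _ (LogVertex.spaceLink (isArc v))) + 0 = _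
  rw [LogVertex.rankTS_spaceLink]

/-- Weight of `[𝒩⊞_v → 𝒩_v] ∘ [λ⊞_{ν₂}] ∘ [id_{⋎+1}]`. [cite: MochizukiAbsTopIII2015, Cor 5.5 (iii) p. 131] -/
theorem pathWtTS_postLogCodPathTS (n : ℤ) (ν₂ : LogVertex (isArc v)) (h₂ : ν₂.isPostLog = false) :
    pathWtTS v (postLogCodPathTS (isArc := isArc) v n ν₂ h₂) = LogVertex.rankTS _ ν₂ := by
  show ((0 + 0) + LogVertex.rankTS _ ν₂) + 0 = _
  omega

/-- Weight of a prefix ending with `[id_⋎] ∘ [log]` (the shape forced by a `post`-move).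
[cite: MochizukiAbsTopIII2015, Cor 5.5 (iii) p. 131] -/
theorem pathWtTS_cons_log_toCore {a : (logShapeTS (isArc := isArc) v).Vertex} (n : ℤ)
    (r' : Path a ((logShapeTS (isArc := isArc) v).base ⟨.row1 (n + 1), row1_mem_portion v (n + 1)⟩)) :
    pathWtTS v ((r'.cons (logEdgeTS v n)).cons (toCoreEdgeTS v n)) = pathWtTS v r' + 3 := by
  show (pathWtTS v r' + 3) + 0 = _
  omega

/-- **The generator pairs of the observable `S_log`** (Cor 5.5 (iii), `TS`-half): (`pre`)
`([𝒩⊞→𝒩]∘[λ⊞_{ν₁}], [𝒩⊞→𝒩]∘[λ⊞_{ν₂}])` for an edge `ε : ν₁ → ν₂` of `Γ⃗^log_v` between pre-log vertices; (`post`)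
`([𝒩⊞→𝒩]∘[λ⊞_{sl}]∘[id_⋎]∘[log], [𝒩⊞→𝒩]∘[λ⊞_{ν₂}]∘[id_{⋎+1}])` for the edge out of the post-log vertex.
[cite: MochizukiAbsTopIII2015, Cor 5.5 (iii) p. 131] -/
inductive LogGenTS : ∀ ⦃c b : (logShapeTS (isArc := isArc) v).Vertex⦄, Path c b → Path c b → Type u
  | pre (ν₁ ν₂ : LogVertex (isArc v)) (ε : LogEdgeTS (isArc v) ν₁ ν₂) (h₁ : ν₁.isPostLog = false)
      (h₂ : ν₂.isPostLog = false) : LogGenTS (lamPathTS v ν₁ h₁) (lamPathTS v ν₂ h₂)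
  | post (ν₁ ν₂ : LogVertex (isArc v)) (ε : LogEdgeTS (isArc v) ν₁ ν₂) (h₁ : ν₁.isPostLog = true)
      (h₂ : ν₂.isPostLog = false) (hsl : (LogVertex.spaceLink (isArc v)).isPostLog = false) (n : ℤ) :
      LogGenTS (postLogDomPathTS v n hsl) (postLogCodPathTS v n ν₂ h₂)

/-- The path functor of `[𝒩⊞_v → 𝒩_v] ∘ [λ⊞_ν]` is `(Λ_ν ⋙ λ⊞_ν) ⋙ (𝒩⊞_v → 𝒩_v)` (`Λ_ν = 𝟭` at a pre-log vertex) — the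
domain of `ι_{v,ε}`. [cite: MochizukiAbsTopIII2015, Def 5.4 (vii) p. 128] -/
theorem pathFunctor_lamPathTS (ν : LogVertex (isArc v)) (hν : ν.isPostLog = false) :
    (L.logDiagramTS v).pathFunctor (lamPathTS v ν hν) =
      (frobeniusTwist L.log ν.isPostLog ⋙ L.lam v ν) ⋙ L.forget v := by
  rw [lamPathTS, DiagramOfCategories.pathFunctor_cons, DiagramOfCategories.pathFunctor_cons,
    DiagramOfCategories.pathFunctor_nil, hν]
  rfl

/-- … and is `λ⊞_ν ⋙ (𝒩⊞_v → 𝒩_v) = λ_{v,ν}` itself — the codomain of `ι_{v,ε}`. [cite: MochizukiAbsTopIII2015, Def 5.4 (vii) p. 128] -/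
theorem pathFunctor_lamPathTS' (ν : LogVertex (isArc v)) (hν : ν.isPostLog = false) :
    L.lam v ν ⋙ L.forget v = (L.logDiagramTS v).pathFunctor (lamPathTS v ν hν) := by
  rw [lamPathTS, DiagramOfCategories.pathFunctor_cons, DiagramOfCategories.pathFunctor_cons,
    DiagramOfCategories.pathFunctor_nil]
  rfl

/-- The path functor of `[𝒩⊞→𝒩]∘[λ⊞_{sl}]∘[id_⋎]∘[log]` is `(Λ_{ν₁} ⋙ λ⊞_{ν₁}) ⋙ (𝒩⊞_v → 𝒩_v)` for the post-log vertex `ν₁`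
(`Λ = log`, and `λ⊞_{sl} = λ⊞_{post-log}` by the proviso of Cor 5.5). [cite: MochizukiAbsTopIII2015, Def 5.4 (vii) p. 128] -/
theorem pathFunctor_postLogDomPathTS (ν₁ : LogVertex (isArc v)) (h₁ : ν₁.isPostLog = true) (n : ℤ)
    (hsl : (LogVertex.spaceLink (isArc v)).isPostLog = false) :
    (L.logDiagramTS v).pathFunctor (postLogDomPathTS v n hsl) =
      (frobeniusTwist L.log ν₁.isPostLog ⋙ L.lam v ν₁) ⋙ L.forget v := by
  rw [postLogDomPathTS, DiagramOfCategories.pathFunctor_cons, DiagramOfCategories.pathFunctor_cons,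
    DiagramOfCategories.pathFunctor_cons, DiagramOfCategories.pathFunctor_cons,
    DiagramOfCategories.pathFunctor_nil, h₁, LogVertex.eq_postLog_of_isPostLog _ h₁, ← L.lam_spaceLink_eq_postLog v]
  rfl

/-- The path functor of `[𝒩⊞→𝒩]∘[λ⊞_{ν₂}]∘[id_{⋎+1}]` is `λ⊞_{ν₂} ⋙ (𝒩⊞_v → 𝒩_v) = λ_{v,ν₂}`. [cite: MochizukiAbsTopIII2015, Def 5.4 (vii) p. 128] -/
theorem pathFunctor_postLogCodPathTS (n : ℤ) (ν₂ : LogVertex (isArc v)) (h₂ : ν₂.isPostLog = false) :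
    L.lam v ν₂ ⋙ L.forget v = (L.logDiagramTS v).pathFunctor (postLogCodPathTS v n ν₂ h₂) := by
  rw [postLogCodPathTS, DiagramOfCategories.pathFunctor_cons, DiagramOfCategories.pathFunctor_cons,
    DiagramOfCategories.pathFunctor_cons, DiagramOfCategories.pathFunctor_nil]
  rfl

variable (T : L.TSHomotopies)

/-- **The prescribed homotopies of the generators**: the `TS`-valued `ι_{v,ε}` of the `TS`-datum `T`, re-typed along the
identifications of the path functors. [cite: MochizukiAbsTopIII2015, Cor 5.5 (iii) p. 131] -/
noncomputable def logGenHomTS : ∀ ⦃c b : (logShapeTS (isArc := isArc) v).Vertex⦄ ⦃g g' : Path c b⦄,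
    LogGenTS v g g' → ((L.logDiagramTS v).pathFunctor g ⟶ (L.logDiagramTS v).pathFunctor g')
  | _, _, _, _, LogGenTS.pre ν₁ ν₂ ε h₁ h₂ =>
    eqToHom (L.pathFunctor_lamPathTS v ν₁ h₁) ≫ T.iota v ε ≫ eqToHom (L.pathFunctor_lamPathTS' v ν₂ h₂)
  | _, _, _, _, LogGenTS.post ν₁ ν₂ ε h₁ h₂ hsl n =>
    eqToHom (L.pathFunctor_postLogDomPathTS v ν₁ h₁ n hsl) ≫ T.iota v ε ≫
      eqToHom (L.pathFunctor_postLogCodPathTS v n ν₂ h₂)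

/-! ## Termination: every move lowers the weight -/

/-- **Every move lowers the weight of the path** (`rankTS_lt_of_logEdgeTS`, `rankTS_lt_of_logEdgeTS_post`): the move
system terminates and has no loops. [cite: MochizukiAbsTopIII2015, Cor 5.5 (iii) p. 131] -/
theorem pathWtTS_lt_of_move {a : (logShapeTS (isArc := isArc) v).Vertex} {p p' : Path a (logShapeTS v).obs}
    (m : DiagramOfCategories.Move (LogGenTS v) p p') : pathWtTS v p' < pathWtTS v p := by
  obtain ⟨c, r, g, g', s, hp, hp'⟩ := m
  cases s with
  | pre ν₁ ν₂ ε h₁ h₂ =>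
    rw [hp, hp', pathWtTS_comp, pathWtTS_comp, pathWtTS_lamPathTS, pathWtTS_lamPathTS]
    exact Nat.add_lt_add_left (LogVertex.rankTS_lt_of_logEdgeTS _ ε h₁) _
  | post ν₁ ν₂ ε h₁ h₂ hsl n =>
    rw [hp, hp', pathWtTS_comp, pathWtTS_comp, pathWtTS_postLogDomPathTS, pathWtTS_postLogCodPathTS]
    exact Nat.add_lt_add_left (LogVertex.rankTS_lt_of_logEdgeTS_post _ ε h₁) _

/-- Along a chain of moves the weight does not increase. [cite: MochizukiAbsTopIII2015, Cor 5.5 (iii) p. 131] -/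
theorem pathWtTS_le_of_chain {a : (logShapeTS (isArc := isArc) v).Vertex} {p q : Path a (logShapeTS v).obs}
    (c : DiagramOfCategories.Chain (LogGenTS v) p q) : pathWtTS v q ≤ pathWtTS v p := by
  induction c with
  | nil p => exact le_rfl
  | cons m rest ih => exact ih.trans (pathWtTS_lt_of_move v m).le

/-- A chain with a first move strictly lowers the weight. [cite: MochizukiAbsTopIII2015, Cor 5.5 (iii) p. 131] -/
theorem pathWtTS_lt_of_cons {a : (logShapeTS (isArc := isArc) v).Vertex} {p p' q : Path a (logShapeTS v).obs}
    (m : DiagramOfCategories.Move (LogGenTS v) p p') (rest : DiagramOfCategories.Chain (LogGenTS v) p' q) :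
    pathWtTS v q < pathWtTS v p :=
  (pathWtTS_le_of_chain v rest).trans_lt (pathWtTS_lt_of_move v m)

/-! ## Unique decomposition of the paths of the `TS`-shape ending at `𝒩_v` -/

/-- Two presentations `p = [𝒩⊞→𝒩] ∘ [λ⊞_ν] ∘ r = [𝒩⊞→𝒩] ∘ [λ⊞_{ν'}] ∘ r'` have the same `λ`-arrow and the same prefix.
[cite: MochizukiAbsTopIII2015, Cor 5.5 (iii) p. 131] -/
theorem eq_of_comp_lamPathTS_eq {a : (logShapeTS (isArc := isArc) v).Vertex}
    {r r' : Path a ((logShapeTS (isArc := isArc) v).base ⟨.core, core_mem_portion v⟩)} {ν ν' : LogVertex (isArc v)}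
    {h : ν.isPostLog = false} {h' : ν'.isPostLog = false}
    (e : r.comp (lamPathTS v ν h) = r'.comp (lamPathTS v ν' h')) : ν = ν' ∧ r = r' := by
  change (r.cons (lamEdgeTS v ν h)).cons (forgetEdgeTS v) = (r'.cons (lamEdgeTS v ν' h')).cons (forgetEdgeTS v) at e
  have e₂ : r.cons (lamEdgeTS v ν h) = r'.cons (lamEdgeTS v ν' h') := eq_of_heq (Path.heq_of_cons_eq_cons e)
  have hν : lamEdgeTS (isArc := isArc) v ν h = lamEdgeTS v ν' h' := eq_of_heq (Path.hom_heq_of_cons_eq_cons e₂)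
  have hr : r = r' := eq_of_heq (Path.heq_of_cons_eq_cons e₂)
  refine ⟨?_, hr⟩
  change DEdge.lam v ν h = DEdge.lam v ν' h' at hν
  injection hν

/-- A presentation `[𝒩⊞→𝒩] ∘ [λ⊞_ν] ∘ r = ([𝒩⊞→𝒩] ∘ [λ⊞_{sl}] ∘ [id_⋎] ∘ [log]) ∘ r'` forces `ν = sl` and `r = [id_⋎] ∘ [log] ∘ r'`.
[cite: MochizukiAbsTopIII2015, Cor 5.5 (iii) p. 131] -/
theorem eq_of_comp_lamPathTS_eq_comp_postLogDomPathTS {a : (logShapeTS (isArc := isArc) v).Vertex}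
    {r : Path a ((logShapeTS (isArc := isArc) v).base ⟨.core, core_mem_portion v⟩)} {ν : LogVertex (isArc v)}
    {h : ν.isPostLog = false} {n : ℤ}
    {r' : Path a ((logShapeTS (isArc := isArc) v).base ⟨.row1 (n + 1), row1_mem_portion v (n + 1)⟩)}
    {hsl : (LogVertex.spaceLink (isArc v)).isPostLog = false}
    (e : r.comp (lamPathTS v ν h) = r'.comp (postLogDomPathTS v n hsl)) :
    ν = LogVertex.spaceLink (isArc v) ∧ r = (r'.cons (logEdgeTS v n)).cons (toCoreEdgeTS v n) := by
  change (r.cons (lamEdgeTS v ν h)).cons (forgetEdgeTS v) =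
    ((((r'.cons (logEdgeTS v n)).cons (toCoreEdgeTS v n)).cons (lamEdgeTS v _ hsl)).cons (forgetEdgeTS v)) at e
  have e₂ : r.cons (lamEdgeTS v ν h) = ((r'.cons (logEdgeTS v n)).cons (toCoreEdgeTS v n)).cons (lamEdgeTS v _ hsl) :=
    eq_of_heq (Path.heq_of_cons_eq_cons e)
  have hν : lamEdgeTS (isArc := isArc) v ν h = lamEdgeTS v _ hsl := eq_of_heq (Path.hom_heq_of_cons_eq_cons e₂)
  have hr : r = (r'.cons (logEdgeTS v n)).cons (toCoreEdgeTS v n) := eq_of_heq (Path.heq_of_cons_eq_cons e₂)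
  refine ⟨?_, hr⟩
  change DEdge.lam v ν h = DEdge.lam v _ hsl at hν
  injection hν

/-- Two presentations `([𝒩⊞→𝒩] ∘ [λ⊞_{sl}] ∘ [id_⋎] ∘ [log]) ∘ r = ([𝒩⊞→𝒩] ∘ [λ⊞_{sl}] ∘ [id_{⋎'}] ∘ [log]) ∘ r'` have
`⋎ = ⋎'` and `r = r'`. [cite: MochizukiAbsTopIII2015, Cor 5.5 (iii) p. 131] -/
theorem eq_of_comp_postLogDomPathTS_eq {a : (logShapeTS (isArc := isArc) v).Vertex} {n n' : ℤ}
    {r : Path a ((logShapeTS (isArc := isArc) v).base ⟨.row1 (n + 1), row1_mem_portion v (n + 1)⟩)}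
    {r' : Path a ((logShapeTS (isArc := isArc) v).base ⟨.row1 (n' + 1), row1_mem_portion v (n' + 1)⟩)}
    {hsl hsl' : (LogVertex.spaceLink (isArc v)).isPostLog = false}
    (e : r.comp (postLogDomPathTS v n hsl) = r'.comp (postLogDomPathTS v n' hsl')) : n = n' ∧ HEq r r' := by
  change ((((r.cons (logEdgeTS v n)).cons (toCoreEdgeTS v n)).cons (lamEdgeTS v _ hsl)).cons (forgetEdgeTS v)) =
    ((((r'.cons (logEdgeTS v n')).cons (toCoreEdgeTS v n')).cons (lamEdgeTS v _ hsl')).cons (forgetEdgeTS v)) at e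
  have e₁ : ((r.cons (logEdgeTS v n)).cons (toCoreEdgeTS v n)).cons (lamEdgeTS v _ hsl) =
      ((r'.cons (logEdgeTS v n')).cons (toCoreEdgeTS v n')).cons (lamEdgeTS v _ hsl') :=
    eq_of_heq (Path.heq_of_cons_eq_cons e)
  have e₂ : (r.cons (logEdgeTS v n)).cons (toCoreEdgeTS v n) = (r'.cons (logEdgeTS v n')).cons (toCoreEdgeTS v n') :=
    eq_of_heq (Path.heq_of_cons_eq_cons e₁)
  have hn : ((logShapeTS (isArc := isArc) v).base ⟨.row1 n, row1_mem_portion v n⟩) =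
      (logShapeTS (isArc := isArc) v).base ⟨.row1 n', row1_mem_portion v n'⟩ := Path.obj_eq_of_cons_eq_cons e₂
  have hn' : n = n' := by
    change ExtVertex.base _ = ExtVertex.base _ at hn
    injection hn with hn
    injection hn with hn
    injection hn
  subst hn'
  have e₃ : r.cons (logEdgeTS v n) = r'.cons (logEdgeTS v n) := eq_of_heq (Path.heq_of_cons_eq_cons e₂)
  exact ⟨rfl, Path.heq_of_cons_eq_cons e₃⟩

end LogFrobeniusSetting

end Literature.AnabelianGeometry.AbsoluteAnabelian
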